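import Summits.CriticalPhenomena.CardyFormulaZ2.Theses.CardyMagicRigidity
import Literature.Probability.RandomPlanarGeometry.NestingTransform
import Literature.Probability.Percolation.FullPlaneCNL
import HarnessLib

/-!
# Vocabulary of line `markov-cascade-one-generation` for crux `NestingRigidity` (stmt-CriticalPhenomena-4835)

Route `CardyMagicRigidity` (sub-problem `CriticalPhenomena/CardyFormulaZ2`), crux
`Summit.CriticalPhenomena.CardyFormulaZ2.Theses.CardyMagicRigidity.NestingRigidity ≡
MagicFormulaZ2 → MagicFormulaT → LoopLimitZ2EqT`.  This file is the **definitions module** of the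
checked skeleton `Cruxes/NestingRigidity/Lines/markov-cascade-one-generation.lean` (planners
`planner-cruxplan-stmt-CriticalPhenomena-4835-markov-cascade-one-g-0` (gen 1) and `…-g2-0` (gen 2,
exterior-carpet fix of `domLoopsZ2`); line lead `prover-line-stmt-CriticalPhenomena-4835-1`): it
carries, verbatim and sorry-free, the skeleton's VOCABULARY (the two critical measures `P2` / `PT`,
closed-b.c. domain ensembles `domLoopsZ2` / `domLoopsT` and their nesting transforms, `firstGen`,
`holeOf`, `TwoSided`, `AdmissibleIn`, the one-generation vocabulary `insideEdges` / `outsideEdges` /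
`insideLoopsZ2` / `condTransformZ2` on `ℤ²` and `loopSitesT` / `insideSitesT` / `outsideSitesT` /
`insideLoopsT` / `condTransformT` on `𝕋`) and the six registered STUB STATEMENTS as named `Prop`s
(`OneGenerationZ2`, `OneGenerationT`, `DeAveraging` (over `DomainTransfer`), `KernelUniqueness` (over
`KernelTransfer`), `CascadeReconstruction` (over `DomainLawTransfer`), `WindowLocality`), so that the
stub helper files `Theorems/CardyMagicRigidityNestingRigidity<StubName>.lean` (each proving
`theorem <stubName> : <Statement>` by name, `--supports stmt-CriticalPhenomena-4835`) and the closing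
skeleton file share ONE copy of every object.  Nothing in this file is asserted: every `def … : Prop` is
a statement to be proved (by a registered stub) or a predicate; the only theorems are the triviality
`domLoopsZ2_subset` and the pure-logic glue `nestingRigidity_of_statements` (registered sub-goal).
The companion module `CardyMagicRigidityDefs.lean` (393 lines) is the vocabulary of
the sibling line `ring-cloud-tomography`; this is a separate topic, hence a separate file.

Objects and the meaning of each statement: see the docstrings (they are the skeleton's, unchanged).
-/

noncomputable section

open MeasureTheory Set Filter
open scoped Topology BigOperators ENNReal Real

namespace Summit.CriticalPhenomena.CardyFormulaZ2.Cruxes.NestingRigidity.MarkovCascadeOneGeneration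

open Literature.Probability.RandomPlanarGeometry Literature.Probability.Percolation
  Literature.Probability.LatticeModels
open Summit.CriticalPhenomena.CardyFormulaZ2.Theses.CardyMagicRigidity

/-! ### Vocabulary of the line (all over existing declarations; no `sorry`) -/

/-- Critical bond percolation on `ℤ²` (`P_{1/2}`), the measure of `MagicFormulaZ2` / `LoopLimitZ2EqT`. -/
abbrev P2 : Measure (BondConfig (Site 2)) := bondPercolation (zdGraph 2) half

/-- Critical site percolation on `𝕋` (`P_{1/2}`), the measure of `MagicFormulaT` / `LoopLimitZ2EqT`. -/
abbrev PT : Measure (SiteConfig (Site 2)) := triSitePercolation half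

/-- The crux's conclusion `X = LoopLimitZ2EqT` is about `siteLoopConfig δ` (definitional check,
`siteLoopConfig_eq`). -/
example : LoopLimitZ2EqT ↔ Tendsto (fun δ : ℝ ↦ LoopConfig.cnLawEDist P2 (bondLoopConfig δ 0) PT
    (siteLoopConfig δ)) (𝓝[>] 0) (𝓝 0) := Iff.rfl

/-- The crux is literally `MagicFormulaZ2 → MagicFormulaT → LoopLimitZ2EqT`. -/
example : NestingRigidity ↔ (MagicFormulaZ2 → MagicFormulaT → LoopLimitZ2EqT) := Iff.rfl

/-! #### Closed-boundary-condition domain ensembles on both lattices -/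

/-- The edges of `ℤ²` both of whose endpoints, drawn at mesh `δ` (`meshPoint δ`), lie in `U`. -/
def meshEdges (U : Set ℂ) (δ : ℝ) : Set (Sym2 (Site 2)) := {e | ∀ x ∈ e, meshPoint δ x ∈ U}

/-- **Closed-b.c. domain loop ensemble on `δℤ² ∩ U`**: the typed interface loops (`loopCurve δ 0`,
DKKMO typing `loopType`, exactly as in `bondLoopConfig δ 0`) of `ω` with every edge not inside `U` declared
CLOSED (`ω ∩ meshEdges U δ`: "dual-wired" = closed boundary condition), RESTRICTED TO THE LOOPS THAT VISIT
AN EDGE OF `U_δ` (`∃ e ∈ γ, e ∈ meshEdges U δ`).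

Why the restriction (gen-2 revision, the one change w.r.t. the gen-1 skeleton `4af5569e805e`).  The medial
loop representation of `ℤ²` is FULLY PACKED: closing every edge at a vertex `v` with `meshPoint δ v ∉ U`
makes `{v}` an isolated primal cluster, and its medial diamond `[E, N, W, S]` IS an `IsInterfaceLoop` of
`ω ∩ meshEdges U δ` (four corner darts around `v`; every middle edge is closed, so `IsMedialTurn` holds
through its `v₁ = v₂` disjunct) of type `1` (counter-clockwise, `loopSignedArea > 0`).  Unrestricted,
`bondLoopConfig δ 0 (ω ∩ meshEdges U δ)` therefore carries a deterministic carpet of diameter-`δ` type-`1`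
loops at EVERY exterior vertex of `ℂ ∖ U`, whereas the honeycomb ensemble `domLoopsT` has no loop farther
than `δ` from `U` (a dart of `IsSiteInterfaceLoop` needs an open site on its left).  Since DKKMO's relation
`LoopConfig.IsClose ε` has no lower diameter cut-off (EVERY loop with trace in `B(0, 1/ε)` must be matched
within `udist ≤ ε`, same type), the carpet makes `IsClose ε` fail SURELY for bounded `U` and small `ε`:
every `d_CN` law comparison of the unrestricted domain ensembles (`KernelTransfer`, `DomainLawTransfer`
below) would be false for this trivial reason, and the stubs consuming them vacuous.  An interface loop all
of whose edges are closed turns around the same vertex at every step, i.e. it is such a diamond; so the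
restriction removes exactly the exterior carpet and keeps every loop bordering an open cluster or a dual
cluster of `U_δ` — all within `δ/2` of `U`.  (On `𝕋` nothing is removed: `domLoopsT` is not fully
packed.)  The nesting transform is unaffected (an exterior diamond weighs `2cos(π/3) = 1`).  Its outermost
loops are the exterior boundaries of the open clusters of `U_δ` visible from `∂U` (type `1`), isolated
open vertices included. -/
def domLoopsZ2 (U : Set ℂ) (δ : ℝ) (ω : BondConfig (Site 2)) : LoopConfig ℂ where
  F i := {u | ∃ (γ : List MedialVertex) (h : IsInterfaceLoop (ω ∩ meshEdges U δ) γ),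
    loopType γ = i ∧ (∃ e ∈ γ, e ∈ meshEdges U δ) ∧
      u = UnbasedLoop.mk (BasedLoop.mk (loopCurve δ 0 γ) (isLoop_loopCurve δ 0 h.ne_nil))}

/-- The restricted domain ensemble is a sub-configuration of the loop representation of the modified
configuration `ω ∩ meshEdges U δ` (same loops, same types; only the exterior diamonds are gone). -/
theorem domLoopsZ2_subset (U : Set ℂ) (δ : ℝ) (ω : BondConfig (Site 2)) (i : Fin 2) :
    (domLoopsZ2 U δ ω).F i ⊆ (bondLoopConfig δ 0 (ω ∩ meshEdges U δ)).F i := by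
  rintro u ⟨γ, h, ht, -, rfl⟩
  exact ⟨γ, h, ht, rfl⟩

/-- **Closed-b.c. domain loop ensemble on `δ𝕋 ∩ U`**: the typed honeycomb interface-loop configuration
(`siteLoopConfig δ`) of `ω` with every site outside `U` declared CLOSED — verbatim the restriction
`ω ∩ triMeshVertices U δ` of `CLE6.lean`'s `triLoopCollection` (Camia–Newman's monochromatic boundary).
No restriction is needed here: every dart of an `IsSiteInterfaceLoop` has an OPEN site on its left, and
open sites lie in `U`, so every loop borders an open cluster of `U_δ` and stays within `δ` of `U`. -/
def domLoopsT (U : Set ℂ) (δ : ℝ) (ω : SiteConfig (Site 2)) : LoopConfig ℂ :=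
  siteLoopConfig δ (ω ∩ triMeshVertices U δ)

/-- The closed-b.c. DOMAIN NESTING TRANSFORM of bond-`ℤ²` in `U` at mesh `δ`:
`M^{ℤ²}_{U,δ}(f) = E_{1/2}[A_f(domLoopsZ2 U δ)]`, `A_f = ∏_u 2cos(∫_{int u} f + π/3)` (`nestingWeight`). -/
def domTransformZ2 (U : Set ℂ) (δ : ℝ) (f : ℂ → ℝ) : ℝ := ∫ ω, (domLoopsZ2 U δ ω).nestingWeight f ∂P2

/-- The closed-b.c. domain nesting transform of site-`𝕋` in `U` at mesh `δ`. -/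
def domTransformT (U : Set ℂ) (δ : ℝ) (f : ℂ → ℝ) : ℝ := ∫ ω, (domLoopsT U δ ω).nestingWeight f ∂PT

/-- **First generation** of a typed loop configuration: the outermost loops, i.e. those whose winding
interior `{W ≠ 0}` is not strictly contained in the interior of another loop of the configuration (types
kept). For the closed-b.c. domain ensembles: the exterior boundaries of the open clusters of `U_δ` visible
from `∂U` (dual-connected, resp. closed-connected, to it), all of type `1`, isolated open vertices/sites along the closed
backbone included (micro first-generation loops: `d_CN` will ask for them too). The law of
`firstGen ∘ domLoops# U δ` is the FIRST-GENERATION KERNEL `Q^{#}_{U,δ}` of the cascade. -/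
def firstGen (c : LoopConfig ℂ) : LoopConfig ℂ :=
  ⟨fun i ↦ {u ∈ c.F i | ∀ v ∈ c.loops, ¬ ({z | u.wind z ≠ 0} ⊂ {z | v.wind z ≠ 0})}⟩

/-- The (winding) INTERIOR of a loop: the open set of points of non-zero winding number — the hole a
first-generation loop leaves for the next generation (for a pinched loop: the union of its lobes; for the
round circle: the open ball). Domains of the line are indexed by loops through `holeOf`. -/
def holeOf (u : UnbasedLoop ℂ) : Set ℂ := {z | u.wind z ≠ 0}

/-- **Two-sided loops**: every point of the trace is accumulated both by the interior `{W ≠ 0}` and by the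
exterior `{W = 0} ∖ trace` — Jordan curves, and the pinched, self-touching loops of continuum percolation
(no triple points, no retraced arcs); excluded are degenerate limits (point loops, arcs traced back and
forth, interior slits), along whose approximants the two lattices resolve `δ`-thin features differently
and `d_CN`-comparisons fail for trivial reasons. The admissible LIMITS of the convergent domain families. -/
def TwoSided (u : UnbasedLoop ℂ) : Prop :=
  u.range ⊆ closure (holeOf u) ∧ u.range ⊆ closure {z | u.wind z = 0 ∧ z ∉ u.range}

/-- Admissible test functions of the crux, localised to the interior of a loop: measurable, bounded,
supported compactly inside `holeOf u` (`tsupport f ⊆ holeOf u`; the hole is open and bounded) and neutral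
(`∫ f = 0`). -/
def AdmissibleIn (u : UnbasedLoop ℂ) (f : ℂ → ℝ) : Prop :=
  Measurable f ∧ (∃ C : ℝ, ∀ z, |f z| ≤ C) ∧ tsupport f ⊆ holeOf u ∧ ∫ z, f z = 0

/-! #### One-generation vocabulary on `ℤ²` (ideator's Sketch §2, verbatim) -/

/-- Primal edges strictly INSIDE the medial circuit `γ`: non-zero winding number of the drawn loop
`loopCurve 1 0 γ` at the edge midpoint (off the trace for `e ∉ γ`), scale-free. -/
def insideEdges (γ : List MedialVertex) : Set MedialVertex :=
  {e | (loopCurve 1 0 γ).wind (medialPoint 1 e) ≠ 0 ∧ e ∉ γ}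

/-- Primal edges strictly OUTSIDE the medial circuit `γ`. -/
def outsideEdges (γ : List MedialVertex) : Set MedialVertex :=
  {e | (loopCurve 1 0 γ).wind (medialPoint 1 e) = 0 ∧ e ∉ γ}

/-- The interface loops of `δℤ²` lying inside the medial circuit `γ` (interior inside the interior of the
drawn `γ`; `γ` itself harmlessly included, its factor being `1` when `∫ f = 0`). -/
def insideLoopsZ2 (δ : ℝ) (γ : List MedialVertex) (ω : BondConfig (Site 2)) : Set (UnbasedLoop ℂ) :=
  {u ∈ (bondLoopConfig δ 0 ω).loops | {z | u.wind z ≠ 0} ⊆ {z | (loopCurve δ 0 γ).wind z ≠ 0}}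

/-- The CONDITIONAL (wired-domain) transform `M_γ(f)` on `ℤ²`: the `I_γ`-conditional expectation of the
twisted weight of the loops inside `γ` (junk `0/0 = 0` if `γ` is impossible). By the cylinder property the
conditioning only pins the states of `γ`'s own edges. -/
def condTransformZ2 (δ : ℝ) (γ : List MedialVertex) (f : ℂ → ℝ) : ℝ :=
  (∫ ω in {ω | IsInterfaceLoop ω γ}, (∏ᶠ u ∈ insideLoopsZ2 δ γ ω, u.nestingFactor f) ∂P2) /
    (P2 {ω | IsInterfaceLoop ω γ}).toReal

/-! #### One-generation vocabulary on `𝕋` -/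

/-- The sites of `𝕋` READ by `IsSiteInterfaceLoop ω γ`: the endpoints of the `𝕋`-edges crossed by the
darts of the honeycomb walk `γ` (open on the left, closed on the right). -/
def loopSitesT {v : HexVertex} (γ : hexGraph.Walk v v) : Set (Site 2) :=
  {x | ∃ d ∈ γ.darts, ∃ e : triGraph.Dart, triEdgeFaces e = (d.snd, d.fst) ∧ (x = e.fst ∨ x = e.snd)}

/-- Sites strictly INSIDE the honeycomb circuit `γ` (non-zero winding number of `siteLoopCurve 1 γ` at the
hexagon centre `triMeshPoint 1 x`, which is off the trace) and not read by `I_γ`. -/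
def insideSitesT {v : HexVertex} (γ : hexGraph.Walk v v) : Set (Site 2) :=
  {x | (siteLoopCurve 1 γ).wind (triMeshPoint 1 x) ≠ 0 ∧ x ∉ loopSitesT γ}

/-- Sites strictly OUTSIDE the honeycomb circuit `γ` and not read by `I_γ`. -/
def outsideSitesT {v : HexVertex} (γ : hexGraph.Walk v v) : Set (Site 2) :=
  {x | (siteLoopCurve 1 γ).wind (triMeshPoint 1 x) = 0 ∧ x ∉ loopSitesT γ}

/-- The honeycomb interface loops of `δ𝕋` lying inside the circuit `γ`. -/
def insideLoopsT (δ : ℝ) {v : HexVertex} (γ : hexGraph.Walk v v) (ω : SiteConfig (Site 2)) :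
    Set (UnbasedLoop ℂ) :=
  {u ∈ (siteLoopConfig δ ω).loops | {z | u.wind z ≠ 0} ⊆ {z | (siteLoopCurve δ γ).wind z ≠ 0}}

/-- The conditional (wired-domain) transform `M_γ(f)` on `𝕋`. -/
def condTransformT (δ : ℝ) {v : HexVertex} (γ : hexGraph.Walk v v) (f : ℂ → ℝ) : ℝ :=
  (∫ ω in {ω | IsSiteInterfaceLoop ω γ}, (∏ᶠ u ∈ insideLoopsT δ γ ω, u.nestingFactor f) ∂PT) /
    (PT {ω | IsSiteInterfaceLoop ω γ}).toReal

/-! ### The six stub STATEMENTS (named `Prop`s; the registered `stub_*` theorems restate them verbatim and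
`Registered.stub_*` are their name-keyed aliases, the hypotheses of `NestingRigidity_of`) -/

/-- Statement of STUB 1 — ONE-GENERATION FACTORISATION on `ℤ²` (ideator's (2c), a lattice theorem): for
`δ > 0`, `f` carried by the interior of the drawn circuit `γ` with `∫ f = 0`, and any outside-cylinder event
`B`, `E[A_f ; I_γ ∩ B] = M_γ(f) · P(I_γ ∩ B)`. -/
def OneGenerationZ2 : Prop :=
  ∀ (δ : ℝ) (γ : List MedialVertex) (f : ℂ → ℝ) (B₀ : Set (Set MedialVertex)),
    0 < δ → (∀ z, f z ≠ 0 → (loopCurve δ 0 γ).wind z ≠ 0) → ∫ z, f z = 0 →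
    MeasurableSet {ω : BondConfig (Site 2) | ω ∩ outsideEdges γ ∈ B₀} →
      ∫ ω in {ω | IsInterfaceLoop ω γ} ∩ {ω | ω ∩ outsideEdges γ ∈ B₀},
          (bondLoopConfig δ 0 ω).nestingWeight f ∂P2 =
        condTransformZ2 δ γ f * (P2 ({ω | IsInterfaceLoop ω γ} ∩ {ω | ω ∩ outsideEdges γ ∈ B₀})).toReal

/-- Statement of STUB 2 — ONE-GENERATION FACTORISATION on `𝕋` (same identity for honeycomb circuits). -/
def OneGenerationT : Prop :=
  ∀ (δ : ℝ) (v : HexVertex) (γ : hexGraph.Walk v v) (f : ℂ → ℝ) (B₀ : Set (Set (Site 2))),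
    0 < δ → (∀ z, f z ≠ 0 → (siteLoopCurve δ γ).wind z ≠ 0) → ∫ z, f z = 0 →
    MeasurableSet {ω : SiteConfig (Site 2) | ω ∩ outsideSitesT γ ∈ B₀} →
      ∫ ω in {ω | IsSiteInterfaceLoop ω γ} ∩ {ω | ω ∩ outsideSitesT γ ∈ B₀},
          (siteLoopConfig δ ω).nestingWeight f ∂PT =
        condTransformT δ γ f * (PT ({ω | IsSiteInterfaceLoop ω γ} ∩ {ω | ω ∩ outsideSitesT γ ∈ B₀})).toReal

/-- `DomainTransfer` — the DE-AVERAGED magic formula in relative lattice clothing: along every family of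
loops `u_δ → u` (loop metric of `d_CN`, two-sided limit) and for every admissible `f` compactly supported in
`holeOf u`, the closed-b.c. domain transforms of bond-`ℤ²` and site-`𝕋` in the holes `holeOf (u_δ)` merge:
`M^{ℤ²}_{U_δ,δ}(f) − M^{𝕋}_{U_δ,δ}(f) → 0`.  (Continuous-convergence form: constant families, lattice
polygons, half-mesh shifts `u − δc` and the random holes of the cascade are the intended instances.) -/
def DomainTransfer : Prop :=
  ∀ (u : UnbasedLoop ℂ) (uδ : ℝ → UnbasedLoop ℂ), TwoSided u → Tendsto uδ (𝓝[>] 0) (𝓝 u) →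
    ∀ f : ℂ → ℝ, AdmissibleIn u f →
      Tendsto (fun δ : ℝ ↦ domTransformZ2 (holeOf (uδ δ)) δ f - domTransformT (holeOf (uδ δ)) δ f)
        (𝓝[>] 0) (𝓝 0)

/-- `KernelTransfer` — the FIRST-GENERATION KERNELS merge: along every family of loops `u_δ → u` with
two-sided limit, the laws of the outermost loops of the two closed-b.c. ensembles in the holes
`holeOf (u_δ)` become `d_CN`-indistinguishable.  `d_CN` has no lower cut-off, so the statement also asks
that the micro first-generation loops of one lattice (isolated open vertices/sites attached to the closed
backbone from `∂U`) be `ε`-shadowed by first-generation loops of the other: with the exterior carpet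
removed (`domLoopsZ2`) these obligations are symmetric and hold w.h.p. by finite energy along the
backbone — the same soup-matching that makes `X = LoopLimitZ2EqT` itself meaningful. -/
def KernelTransfer : Prop :=
  ∀ (u : UnbasedLoop ℂ) (uδ : ℝ → UnbasedLoop ℂ), TwoSided u → Tendsto uδ (𝓝[>] 0) (𝓝 u) →
    Tendsto (fun δ : ℝ ↦ LoopConfig.cnLawEDist P2 (fun ω ↦ firstGen (domLoopsZ2 (holeOf (uδ δ)) δ ω))
      PT (fun ω ↦ firstGen (domLoopsT (holeOf (uδ δ)) δ ω))) (𝓝[>] 0) (𝓝 0)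

/-- `DomainLawTransfer` — closed-b.c. domain UNIVERSALITY in balls: for every `R > 0` the full closed-b.c.
loop ensembles of bond-`ℤ²` and site-`𝕋` in `B(0, R)` (all generations, boundary-touching loops and the
micro soups of both lattices inside and along the boundary included; nothing outside `B(0, R + δ)` on
either side, by the restriction in `domLoopsZ2`) become `d_CN`-indistinguishable as `δ → 0⁺`. -/
def DomainLawTransfer : Prop :=
  ∀ R : ℝ, 0 < R → Tendsto (fun δ : ℝ ↦ LoopConfig.cnLawEDist P2 (domLoopsZ2 (Metric.ball 0 R) δ)
    PT (domLoopsT (Metric.ball 0 R) δ)) (𝓝[>] 0) (𝓝 0)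

/-- Statement of STUB 3 — DE-AVERAGING (load-bearing): the two one-generation factorisations and the two
magic formulas (the crux's antecedents, in the route's own words) give `DomainTransfer`. -/
def DeAveraging : Prop :=
  OneGenerationZ2 → OneGenerationT → MagicFormulaZ2 → MagicFormulaT → DomainTransfer

/-- Statement of STUB 4 — FIRST-GENERATION KERNEL UNIQUENESS (Transfer C⁺, first half). -/
def KernelUniqueness : Prop := DomainTransfer → KernelTransfer

/-- Statement of STUB 5 — CASCADE RECONSTRUCTION (Transfer C⁺ ⇒ domain laws). -/
def CascadeReconstruction : Prop := KernelTransfer → DomainLawTransfer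

/-- Statement of STUB 6 — WINDOW LOCALITY ("free boundary = no boundary" for loops inside the window). -/
def WindowLocality : Prop := DomainLawTransfer → LoopLimitZ2EqT

/-! ### Glue: the six statements imply the crux (pure logic) -/

/-- **The six stub statements imply the crux, by name** (pure logic, the composition of the
skeleton): given the crux's antecedents `MagicFormulaZ2`, `MagicFormulaT`, `DeAveraging` (fed by
the two one-generation factorisations) yields `DomainTransfer`, `KernelUniqueness` turns it into
`KernelTransfer`, `CascadeReconstruction` into `DomainLawTransfer`, and `WindowLocality` removes the
boundary: `LoopLimitZ2EqT`.  Registered sub-goal anchoring this definitions module on the crux. -/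
theorem nestingRigidity_of_statements : OneGenerationZ2 → OneGenerationT → DeAveraging →
    KernelUniqueness → CascadeReconstruction → WindowLocality → NestingRigidity :=
  fun h1 h2 h3 h4 h5 h6 hZ2 hT ↦ h6 (h5 (h4 (h3 h1 h2 hZ2 hT)))

end Summit.CriticalPhenomena.CardyFormulaZ2.Cruxes.NestingRigidity.MarkovCascadeOneGeneration

end
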